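import Mathlib.Analysis.Calculus.Deriv.Add
import Mathlib.Analysis.Calculus.Deriv.Mul
import Mathlib.Analysis.SpecialFunctions.ExpDeriv
import Literature.Probability.Percolation.RussoFormula
import Literature.Probability.Percolation.LongRangeKernelPercolationProofs
import HarnessLib

/-!
# Russo's formula for product Bernoulli measures along a differentiable path of parameters

Topic `Literature/Probability/Percolation`. The tree's Russo formula
(`russo_formula_sum_holds`, `RussoFormula.lean`) is the one-parameter statement for
`bondPercolation G p`. Long-range percolation with a kernel `J` is parametrised by `β` through
ALL the edge probabilities `p_e(β) = 1 - e^{-β J_e}` at once, so the sharpness argument of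
Duminil-Copin–Tassion (2016) in Hutchcroft's setting needs Russo's formula in the genuinely
multi-parameter form of Russo's paper (Z. Wahrsch. 56 (1981), §4, Lemma 3: independent
parameters `x_i` on the coordinates, `∂/∂x_i μ_x(A) = μ_x(δ_i A)`, summed along the diagonal),
i.e. the chain rule along a differentiable path `β ↦ (p_e(β))_e`:

* `hasDerivAt_prodBernoulli_real` — for an increasing event `A` determined by a finite set `K`
  and parameters `p b : ι → [0,1]` with `b ↦ p_e(b)` differentiable at `β` for `e ∈ K`,
  `d/db P_{p(b)}(A) |_{b=β} = Σ_{e ∈ K} p_e'(β) · P_{p(β)}(e pivotal for A)`;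
* `hasDerivAt_kernelPercolation_real` — for the long-range model `ℙ_{β,J}`
  (`kernelPercolation J β`), `d/dβ ℙ_β(A) = Σ_{e ∈ K} J_e e^{-βJ_e} ℙ_β(e pivotal for A)`
  (`β > 0`, `J ≥ 0`), the form used by Duminil-Copin–Tassion ("`d/dβ`" of connection
  probabilities, 2016, proof of Lemma 1.4 / Thm. 1.1, item 2) and Hutchcroft (2022, via
  [duminil2015new]).

Proof: mirror of `RussoFormula.lean` — cylinder decomposition of `A` over `K`
(`DeterminedBy.eq_biUnion_localCylinder`, `prodBernoulli_real_localCylinder`), product rule,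
and the pairing `S ↔ S ∪ {e}` identifying the `e`-th term with `p_e' P(e pivotal)`
(`Russo.isPivotal_iff_of_notMem`, `Russo.determinedBy_isPivotal`).

## References

* L. Russo, *On the critical percolation probabilities*, Z. Wahrsch. verw. Gebiete 56 (1981)
  229–237, §4, Lemma 3.
* H. Duminil-Copin, V. Tassion, *A new proof of the sharpness of the phase transition for
  Bernoulli percolation and the Ising model*, Comm. Math. Phys. 343 (2016) 725–745, §1.
* G. Grimmett, *Percolation*, 2nd ed. (1999), Thm. 2.25 (Russo's formula) and Thm. 2.32.
-/

noncomputable section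

namespace Literature.Probability.Percolation

open MeasureTheory Literature.Probability.LatticeModels

variable {ι : Type*}

namespace RussoPath

/-! #### The one-coordinate weights along the path -/

/-- The weight of the cylinder `[S]_K` at coordinate `i` for the parameter vector `q`:
`q_i` if `i ∈ S`, `1 - q_i` otherwise. [cite: RussoZW1981, §4 Lemma 3 (proof)] -/
theorem prodBernoulli_real_localCylinder_eq (p : ι → unitInterval) (K : Finset ι) (S : Finset ι)
    [DecidableEq ι] :
    (prodBernoulli p).real (localCylinder (↑K : Set ι) ↑S) =
      ∏ i ∈ K, (if i ∈ S then (p i : ℝ) else 1 - (p i : ℝ)) := by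
  rw [prodBernoulli_real_localCylinder]
  refine Finset.prod_congr rfl fun i _ => ?_
  simp only [Finset.mem_coe]

open Classical in
/-- For an event `B` determined by the finite set `K`:
`P_q(B) = Σ_{S ⊆ K, S ∈ B} ∏_{i ∈ K} w_i(S, q)`. [cite: RussoZW1981, §4 Lemma 3 (proof)] -/
theorem prodBernoulli_real_eq_sum_powerset [DecidableEq ι] {B : Set (Set ι)} {K : Finset ι}
    (hB : DeterminedBy B (↑K : Set ι)) (p : ι → unitInterval) :
    (prodBernoulli p).real B =
      ∑ S ∈ K.powerset, if (↑S : Set ι) ∈ B then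
        ∏ i ∈ K, (if i ∈ S then (p i : ℝ) else 1 - (p i : ℝ)) else 0 := by
  classical
  conv_lhs => rw [hB.eq_biUnion_localCylinder]
  rw [measureReal_biUnion_finset]
  · rw [Finset.sum_filter]
    refine Finset.sum_congr rfl fun S _ => ?_
    split_ifs
    · exact prodBernoulli_real_localCylinder_eq p K S
    · rfl
  · intro S hS T hT hST
    simp only [Finset.coe_filter, Set.mem_setOf_eq, Finset.mem_powerset] at hS hT
    exact Russo.disjoint_localCylinder hS.1 hT.1 hST
  · intro S _
    exact measurableSet_localCylinder K.finite_toSet.countable _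

end RussoPath

/-- **Russo's formula along a differentiable path of parameters** (Russo 1981, §4, Lemma 3, in
its multi-parameter form: `∂/∂x_i μ_x(A) = μ_x(δ_i A)` and the chain rule). Let `A` be an
increasing event determined by the finite set `K`, and let the parameters `p b : ι → [0,1]`
depend on a real parameter `b` with `b ↦ p_e(b)` differentiable at `β` with derivative `p'_e`
for every `e ∈ K`. Then `b ↦ P_{p(b)}(A)` is differentiable at `β` with derivative
`Σ_{e ∈ K} p'_e · P_{p(β)}(e is pivotal for A)`. [cite: RussoZW1981, §4 Lemma 3] -/
theorem hasDerivAt_prodBernoulli_real [DecidableEq ι] (p : ℝ → ι → unitInterval)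
    {A : Set (Set ι)} (hA : IsUpperSet A) {K : Finset ι} (hK : DeterminedBy A (↑K : Set ι))
    (β : ℝ) (p' : ι → ℝ) (hp : ∀ e ∈ K, HasDerivAt (fun b => (p b e : ℝ)) (p' e) β) :
    HasDerivAt (fun b => (prodBernoulli (p b)).real A)
      (∑ e ∈ K, p' e * (prodBernoulli (p β)).real {ω | IsPivotal A e ω}) β := by
  classical
  -- the weights and their derivatives
  set w : Finset ι → ι → ℝ → ℝ := fun S i b => if i ∈ S then (p b i : ℝ) else 1 - (p b i : ℝ)
    with hw
  set dw : Finset ι → ι → ℝ := fun S i => if i ∈ S then p' i else -p' i with hdw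
  have hwd : ∀ S, ∀ i ∈ K, HasDerivAt (w S i) (dw S i) β := by
    intro S i hi
    by_cases hiS : i ∈ S
    · have h1 : w S i = fun b => (p b i : ℝ) := by funext b; simp [hw, hiS]
      have h2 : dw S i = p' i := by simp [hdw, hiS]
      rw [h1, h2]; exact hp i hi
    · have h1 : w S i = fun b => 1 - (p b i : ℝ) := by funext b; simp [hw, hiS]
      have h2 : dw S i = -p' i := by simp [hdw, hiS]
      rw [h1, h2]; exact (hp i hi).const_sub 1
  -- `P_{p(b)}(A)` is the cylinder polynomial
  have hrepr : (fun b => (prodBernoulli (p b)).real A) =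
      fun b => ∑ S ∈ K.powerset, if (↑S : Set ι) ∈ A then ∏ i ∈ K, w S i b else 0 := by
    funext b
    rw [RussoPath.prodBernoulli_real_eq_sum_powerset hK (p b)]
  rw [hrepr]
  -- differentiate term by term
  have hderiv : HasDerivAt
      (fun b => ∑ S ∈ K.powerset, if (↑S : Set ι) ∈ A then ∏ i ∈ K, w S i b else 0)
      (∑ S ∈ K.powerset, if (↑S : Set ι) ∈ A then
        ∑ e ∈ K, (∏ j ∈ K.erase e, w S j β) * dw S e else 0) β := by
    refine HasDerivAt.fun_sum fun S _ => ?_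
    split_ifs with hSA
    · have := HasDerivAt.fun_finsetProd (u := K) (x := β) (fun i hi => hwd S i hi)
      simpa [smul_eq_mul] using this
    · simpa using hasDerivAt_const β (0 : ℝ)
  -- exchange the sums and pair `S ↔ insert e S`
  convert hderiv using 1
  have hpush : (∑ S ∈ K.powerset, if (↑S : Set ι) ∈ A then
      ∑ e ∈ K, (∏ j ∈ K.erase e, w S j β) * dw S e else 0) =
      ∑ S ∈ K.powerset, ∑ e ∈ K, (if (↑S : Set ι) ∈ A then
        (∏ j ∈ K.erase e, w S j β) * dw S e else 0) := by
    refine Finset.sum_congr rfl fun S _ => ?_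
    split_ifs <;> simp
  rw [hpush, Finset.sum_comm]
  refine Finset.sum_congr rfl fun e he => ?_
  -- the `e`-th term: `p'_e · P(e pivotal)`
  have hpiv : (prodBernoulli (p β)).real {ω | IsPivotal A e ω} =
      ∑ S ∈ (K.erase e).powerset, if (↑S : Set ι) ∈ {ω | IsPivotal A e ω} then
        ∏ i ∈ K.erase e, w S i β else 0 :=
    RussoPath.prodBernoulli_real_eq_sum_powerset (Russo.determinedBy_isPivotal hK e) (p β)
  rw [hpiv, Finset.mul_sum]
  have hpow : K.powerset = (K.erase e).powerset ∪ (K.erase e).powerset.image (insert e) := by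
    rw [← Finset.powerset_insert, Finset.insert_erase he]
  have hdisj : Disjoint (K.erase e).powerset ((K.erase e).powerset.image (insert e)) := by
    rw [Finset.disjoint_left]
    intro S hS hS'
    obtain ⟨T, -, rfl⟩ := Finset.mem_image.1 hS'
    have := Finset.mem_powerset.1 hS (Finset.mem_insert_self e T)
    simp at this
  have hinj : Set.InjOn (insert e) (↑(K.erase e).powerset : Set (Finset ι)) := by
    intro S hS T hT hST
    have heS : e ∉ S := fun h => by simpa using Finset.mem_powerset.1 hS h
    have heT : e ∉ T := fun h => by simpa using Finset.mem_powerset.1 hT h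
    rw [← Finset.erase_insert heS, ← Finset.erase_insert heT, hST]
  symm
  rw [hpow, Finset.sum_union hdisj, Finset.sum_image hinj, ← Finset.sum_add_distrib]
  refine Finset.sum_congr rfl fun S hS => ?_
  have heS : e ∉ S := fun h => by simpa using Finset.mem_powerset.1 hS h
  have heS' : e ∉ (↑S : Set ι) := by simpa using heS
  have hdS : dw S e = -p' e := by simp [hdw, heS]
  have hdiS : dw (insert e S) e = p' e := by simp [hdw]
  -- off `e` the weights of `S` and `insert e S` agree
  have hwi : ∏ j ∈ K.erase e, w (insert e S) j β = ∏ j ∈ K.erase e, w S j β := by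
    refine Finset.prod_congr rfl fun j hj => ?_
    have hje : j ≠ e := Finset.ne_of_mem_erase hj
    simp [hw, Finset.mem_insert, hje]
  rw [hdS, hdiS, hwi, Finset.coe_insert]
  simp only [Set.mem_setOf_eq]
  have hpivS : IsPivotal A e ↑S ↔ insert e (↑S : Set ι) ∈ A ∧ (↑S : Set ι) ∉ A :=
    Russo.isPivotal_iff_of_notMem hA heS'
  by_cases hSA : (↑S : Set ι) ∈ A
  · have hiA : insert e (↑S : Set ι) ∈ A := hA (Set.subset_insert e _) hSA
    have hnp : ¬ IsPivotal A e ↑S := fun h => (hpivS.1 h).2 hSA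
    simp [hSA, hiA, hnp]
  · by_cases hiA : insert e (↑S : Set ι) ∈ A
    · have hpv : IsPivotal A e ↑S := hpivS.2 ⟨hiA, hSA⟩
      simp [hSA, hiA, hpv]; ring
    · have hnp : ¬ IsPivotal A e ↑S := fun h => hiA (hpivS.1 h).1
      simp [hSA, hiA, hnp]

/-! ### The long-range model: `d/dβ ℙ_{β,J}(A)` -/

variable {d : ℕ}

/-- The edge probability `β ↦ 1 - e^{-βJ_e}` is differentiable with derivative `J_e e^{-βJ_e}`
on `β > 0` (where the clamp is inactive), for `J_e ≥ 0`. [cite: Hutchcroft2022, §1 (p. 3)] -/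
theorem hasDerivAt_coe_kernelEdgeProb {J : Sym2 (Site d) → ℝ} {e : Sym2 (Site d)} (hJ : 0 ≤ J e)
    {β : ℝ} (hβ : 0 < β) :
    HasDerivAt (fun b : ℝ => (kernelEdgeProb J b e : ℝ)) (J e * Real.exp (-(β * J e))) β := by
  have heq : (fun b : ℝ => (kernelEdgeProb J b e : ℝ)) =ᶠ[nhds β]
      fun b => 1 - Real.exp (-(b * J e)) := by
    filter_upwards [lt_mem_nhds hβ] with b hb
    exact coe_kernelEdgeProb (mul_nonneg hb.le hJ)
  refine HasDerivAt.congr_of_eventuallyEq ?_ heq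
  have h1 : HasDerivAt (fun b : ℝ => -(b * J e)) (-(J e)) β := by
    have hfun : (fun b : ℝ => -(b * J e)) = fun b => b * (-(J e)) := by funext b; ring
    rw [hfun]; exact hasDerivAt_mul_const _
  have h2 := h1.exp
  have h3 := h2.const_sub 1
  convert h3 using 1
  ring

/-- **Russo's formula for long-range percolation in the parameter `β`**: for a nonnegative kernel
`J`, `β > 0` and an increasing event `A` determined by a finite set `K` of edges,
`d/dβ ℙ_{β,J}(A) = Σ_{e ∈ K} J_e e^{-βJ_e} ℙ_{β,J}(e pivotal for A)`. (Duminil-Copin–Tassion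
2016, the derivative in `β` of `ℙ_β(0 ↔ ∂Λ_n)` in the proof of their Lemma 1.4; Russo 1981.)
[cite: RussoZW1981, §4 Lemma 3] -/
theorem hasDerivAt_kernelPercolation_real {J : Sym2 (Site d) → ℝ} (hJ : ∀ e, 0 ≤ J e)
    {A : Set (BondConfig (Site d))} (hA : IsUpperSet A) {K : Finset (Sym2 (Site d))}
    (hK : DeterminedBy A (↑K : Set (Sym2 (Site d)))) {β : ℝ} (hβ : 0 < β) :
    HasDerivAt (fun b : ℝ => (kernelPercolation J b).real A)
      (∑ e ∈ K, J e * Real.exp (-(β * J e)) *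
        (kernelPercolation J β).real {ω | IsPivotal A e ω}) β := by
  classical
  exact hasDerivAt_prodBernoulli_real (fun b => kernelEdgeProb J b) hA hK β
    (fun e => J e * Real.exp (-(β * J e))) fun e _ => hasDerivAt_coe_kernelEdgeProb (hJ e) hβ

end Literature.Probability.Percolation

end
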